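import Summits.AtomisticToContinuum.HydrodynamicLimit.Theorems.JParityClosureOddContactSymmetryWindowStaticsOne
import Literature.MathematicalPhysics.KineticTheory.HardSphereEulerProofs
import HarnessLib

/-!
# Tools for a star of velocity shells under the free rung-0 product law
# (`LambertianContactSwap.LambertianEuler`, stmt-AtomisticToContinuum-11854, line `Sketch`; lead c10,
# piece W3 `StarShells`, part 1 of 2: shell sections, star factorisation, leaf integrals)

Static tools for lead c10's concentration theorem, used by `…StarShells.pi_starShells_le`.  Under the
FREE rung-0 law `U_n := ⊗_{i < n} (Haar ⊗ N(w, ϑ id))` on `Config n (Fin 3) 𝕋³` the velocity SHELL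
of width `δ` of the ordered pair `(a, b)` is the event `ε ≤ d(x_a, x_b) ≤ ε + δ ‖v_a − v_b‖`
(minimal-image distance, `Torus.norm_geometry_sepVec`).

* ONE SHELL SECTION (`volume_sepVec_shell_le`): for a fixed centre `x_a` and `0 ≤ δ ≤ ε ≤ 1/4`,
  `vol {x_b | ε ≤ d(x_a, x_b) ≤ ε + δ g} ≤ (3 v₁ + 64) ε² δ (1 + g)³`: if `ε + δ g < 1/2` by the sharp
  shell volume `v₁ ((ε + δ g)³ − ε³)` (`volume_shell_le`) and `δ g ≤ ε g`; otherwise `δ g ≥ 1/4` and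
  `vol ≤ 1 ≤ 64 (δ g)³ ≤ 64 ε² δ (1 + g)³`.
* STAR FACTORISATION (`lintegral_pi_centre_mul_prod_eq`, abstract): under a product of copies of a
  probability measure `μ`,
  `∫⁻ F(y a) Π_i G_i(y a, y (bs i)) = ∫⁻ F(z) Π_i (∫⁻ G_i(z, q) dμ(q)) dμ(z)` for distinct leaves
  `bs i ≠ a` — induction on the number of leaves, integrating out the last leaf by Tonelli over one
  coordinate of `Measure.pi` (`lmarginal_singleton`, `lintegral_eq_of_lmarginal_eq`); the base case
  is `measurePreserving_eval`.
* LEAF INTEGRAL (`lintegral_leafShell_le`): for a fixed centre `(x_a, v_a)`,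
  `∫∫ 𝟙{shell} (1 + ‖v_b‖)^{n'} dx_b dγ(v_b) ≤ (3v₁+64) ε² δ (1 + ‖v_a‖)³ M_{n'+3}`
  (`1 + ‖v_a − v_b‖ ≤ (1 + ‖v_a‖)(1 + ‖v_b‖)`), with the Gaussian moments
  `M_p := ∫ (1 + ‖v‖)^p dN(w, ϑ id) < ∞` (Fernique, `IsGaussian.memLp_id`;
  `integrable_one_add_norm_pow`, `lintegral_one_add_norm_pow`).

References: Cercignani–Illner–Pulvirenti 1994 §2.2 (collision cylinders and shells);
Gallagher–Saint-Raymond–Texier 2013, Lemma 4.1.2.  All statements [folklore].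
-/

noncomputable section

namespace Summit.AtomisticToContinuum.HydrodynamicLimit.Theorems.LambertianContactSwapLambertianEulerStarShellsTools

open scoped BigOperators Topology ENNReal InnerProductSpace
open MeasureTheory ProbabilityTheory Filter Set
open Literature.MathematicalPhysics.KineticTheory Literature.MathematicalPhysics.StatisticalMechanics
open Literature.Analysis.FluidPDE

/-! ## Elementary inequalities -/

/-- `1 + A + Σ_i B_i ≤ (1 + A) Π_i (1 + B_i)` for `A, B_i ≥ 0`. [folklore] -/
theorem one_add_add_sum_le {A : ℝ} (hA : 0 ≤ A) :
    ∀ (m : ℕ) (B : Fin m → ℝ), (∀ i, 0 ≤ B i) →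
      1 + A + ∑ i, B i ≤ (1 + A) * ∏ i, (1 + B i) := by
  intro m
  induction m with
  | zero =>
      intro B _
      simp
  | succ m ih =>
      intro B hB
      rw [Fin.sum_univ_castSucc, Fin.prod_univ_castSucc]
      have h1 := ih (fun i => B (Fin.castSucc i)) fun i => hB _
      have hS : 0 ≤ ∑ i : Fin m, B (Fin.castSucc i) := Finset.sum_nonneg fun i _ => hB _
      have hY : 1 ≤ (1 + A) * ∏ i : Fin m, (1 + B (Fin.castSucc i)) := by linarith
      have hb := hB (Fin.last m)
      have h2 : B (Fin.last m) * 1 ≤ B (Fin.last m) * ((1 + A) * ∏ i : Fin m, (1 + B (Fin.castSucc i))) :=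
        mul_le_mul_of_nonneg_left hY hb
      nlinarith [h1, h2]

/-- `1 + ‖u − v‖ ≤ (1 + ‖u‖) (1 + ‖v‖)`. [folklore] -/
theorem one_add_norm_sub_le (u v : V3) : 1 + ‖u - v‖ ≤ (1 + ‖u‖) * (1 + ‖v‖) := by
  have h := norm_sub_le u v
  nlinarith [norm_nonneg u, norm_nonneg v, mul_nonneg (norm_nonneg u) (norm_nonneg v)]

/-! ## Gaussian moments of `(1 + ‖v‖)^p` -/

/-- `(1 + ‖v‖)^p` is integrable under `N(w, ϑ id)` (all Gaussian moments are finite, Fernique /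
`IsGaussian.memLp_id`). [folklore] -/
theorem integrable_one_add_norm_pow (w : V3) (ϑ : ℝ) (p : ℕ) :
    Integrable (fun v : V3 => (1 + ‖v‖) ^ p) (gaussMeasure w ϑ) := by
  have h0 : MemLp (fun v : V3 => ‖v‖) (p : ℝ≥0∞) (gaussMeasure w ϑ) :=
    (IsGaussian.memLp_id (gaussMeasure w ϑ) p (ENNReal.natCast_ne_top p)).norm
  have h1 : MemLp (fun v : V3 => 1 + ‖v‖) (p : ℝ≥0∞) (gaussMeasure w ϑ) :=
    (memLp_const (1 : ℝ)).add h0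
  refine h1.integrable_norm_pow'.congr (ae_of_all _ fun v => ?_)
  change ‖1 + ‖v‖‖ ^ p = (1 + ‖v‖) ^ p
  rw [Real.norm_of_nonneg (by positivity)]

/-- `∫⁻ (1 + ‖v‖)^p dN(w, ϑ id) = ofReal (∫ (1 + ‖v‖)^p dN(w, ϑ id))`. [folklore] -/
theorem lintegral_one_add_norm_pow (w : V3) (ϑ : ℝ) (p : ℕ) :
    ∫⁻ v, ENNReal.ofReal ((1 + ‖v‖) ^ p) ∂gaussMeasure w ϑ =
      ENNReal.ofReal (∫ v, (1 + ‖v‖) ^ p ∂gaussMeasure w ϑ) := by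
  have h0 : ∀ v : V3, 0 ≤ (1 + ‖v‖) ^ p := fun v => by positivity
  exact (ofReal_integral_eq_lintegral_ofReal (integrable_one_add_norm_pow w ϑ p)
    (Eventually.of_forall h0)).symm

/-- `1 ≤ ∫ (1 + ‖v‖)^p dN(w, ϑ id)`. [folklore] -/
theorem one_le_integral_one_add_norm_pow (w : V3) (ϑ : ℝ) (p : ℕ) :
    1 ≤ ∫ v, (1 + ‖v‖) ^ p ∂gaussMeasure w ϑ := by
  have h1 : ∫ _v, (1 : ℝ) ∂gaussMeasure w ϑ = 1 := by simp
  calc (1 : ℝ) = ∫ _v, (1 : ℝ) ∂gaussMeasure w ϑ := h1.symm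
    _ ≤ ∫ v, (1 + ‖v‖) ^ p ∂gaussMeasure w ϑ :=
        integral_mono (integrable_const 1) (integrable_one_add_norm_pow w ϑ p) fun v =>
          one_le_pow₀ (le_add_of_nonneg_right (norm_nonneg v))

/-! ## One shell section in the positions -/

/-- **Haar volume of one velocity-shell section.**  For a fixed centre `x_a ∈ 𝕋³`,
`0 < ε ≤ 1/4`, `0 ≤ δ ≤ ε` and `g ≥ 0`:
`vol {x_b | ε ≤ d(x_a, x_b) ≤ ε + δ g} ≤ (3 v₁ + 64) ε² δ (1 + g)³` — the sharp shell volume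
`v₁((ε + δg)³ − ε³) ≤ 3 v₁ ε² δ (1+g)³` when `ε + δ g < 1/2` (`volume_shell_le`, `δ g ≤ ε g`), and
`vol ≤ 1 ≤ 64 (δ g)³ ≤ 64 ε² δ (1 + g)³` otherwise. [folklore] -/
theorem volume_sepVec_shell_le {ε δ g : ℝ} (hε : 0 < ε) (hε4 : ε ≤ 1 / 4) (hδ : 0 ≤ δ)
    (hδε : δ ≤ ε) (hg : 0 ≤ g) (xa : T3) :
    volume {xb : T3 | ε ≤ ‖(Torus.geometry (Fin 3)).sepVec xa xb‖ ∧
        ‖(Torus.geometry (Fin 3)).sepVec xa xb‖ ≤ ε + δ * g} ≤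
      ENNReal.ofReal ((3 * v₁ + 64) * ε ^ 2 * δ * (1 + g) ^ 3) := by
  have hv := v₁_pos
  have hset : {xb : T3 | ε ≤ ‖(Torus.geometry (Fin 3)).sepVec xa xb‖ ∧
      ‖(Torus.geometry (Fin 3)).sepVec xa xb‖ ≤ ε + δ * g} =
      {y : T3 | ε ≤ Torus.euclidDist y xa ∧ Torus.euclidDist y xa ≤ ε + δ * g} := by
    ext y
    simp only [mem_setOf_eq, Torus.norm_geometry_sepVec, Torus.euclidDist_comm xa y]
  rw [hset]
  have hδg : 0 ≤ δ * g := mul_nonneg hδ hg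
  have hpos : 0 ≤ (3 * v₁ + 64) * ε ^ 2 * δ * (1 + g) ^ 3 := by positivity
  by_cases hcase : ε + δ * g < 1 / 2
  · refine (volume_shell_le hε hδg hcase xa).trans (ENNReal.ofReal_le_ofReal ?_)
    have h1 : (ε + δ * g) ^ 3 - ε ^ 3 =
        δ * (g * (3 * ε ^ 2 + 3 * ε * (δ * g) + (δ * g) ^ 2)) := by ring
    have hdg : δ * g ≤ ε * g := mul_le_mul_of_nonneg_right hδε hg
    have h2 : 3 * ε ^ 2 + 3 * ε * (δ * g) + (δ * g) ^ 2 ≤ ε ^ 2 * (3 + 3 * g + g ^ 2) := by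
      have h21 : 3 * ε * (δ * g) ≤ 3 * ε * (ε * g) :=
        mul_le_mul_of_nonneg_left hdg (by positivity)
      have h22 : (δ * g) ^ 2 ≤ (ε * g) ^ 2 := pow_le_pow_left₀ hδg hdg 2
      nlinarith [h21, h22]
    have h3 : g * (3 + 3 * g + g ^ 2) ≤ 3 * (1 + g) ^ 3 := by
      nlinarith [hg, mul_nonneg hg hg, mul_nonneg (mul_nonneg hg hg) hg]
    have h4 : g * (3 * ε ^ 2 + 3 * ε * (δ * g) + (δ * g) ^ 2) ≤ 3 * ε ^ 2 * (1 + g) ^ 3 := by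
      calc g * (3 * ε ^ 2 + 3 * ε * (δ * g) + (δ * g) ^ 2)
          ≤ g * (ε ^ 2 * (3 + 3 * g + g ^ 2)) := mul_le_mul_of_nonneg_left h2 hg
        _ = ε ^ 2 * (g * (3 + 3 * g + g ^ 2)) := by ring
        _ ≤ ε ^ 2 * (3 * (1 + g) ^ 3) := mul_le_mul_of_nonneg_left h3 (by positivity)
        _ = 3 * ε ^ 2 * (1 + g) ^ 3 := by ring
    have h5 : v₁ * ((ε + δ * g) ^ 3 - ε ^ 3) ≤ v₁ * (δ * (3 * ε ^ 2 * (1 + g) ^ 3)) := by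
      rw [h1]
      exact mul_le_mul_of_nonneg_left (mul_le_mul_of_nonneg_left h4 hδ) hv.le
    have h6 : 0 ≤ 64 * ε ^ 2 * δ * (1 + g) ^ 3 := by positivity
    nlinarith [h5, h6]
  · have hdg : 1 / 4 ≤ δ * g := by linarith
    calc volume {y : T3 | ε ≤ Torus.euclidDist y xa ∧ Torus.euclidDist y xa ≤ ε + δ * g}
        ≤ 1 := prob_le_one
      _ = ENNReal.ofReal 1 := ENNReal.ofReal_one.symm
      _ ≤ _ := by
          refine ENNReal.ofReal_le_ofReal ?_
          have h1 : (1 : ℝ) ≤ 64 * (δ * g) ^ 3 := by nlinarith [hdg, mul_nonneg hδg hδg]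
          have h2 : δ ^ 3 ≤ ε ^ 2 * δ := by
            have : δ ^ 2 ≤ ε ^ 2 := pow_le_pow_left₀ hδ hδε 2
            nlinarith [this, hδ]
          have h3 : g ^ 3 ≤ (1 + g) ^ 3 := pow_le_pow_left₀ hg (by linarith) 3
          have h4 : (δ * g) ^ 3 ≤ ε ^ 2 * δ * (1 + g) ^ 3 := by
            rw [mul_pow]
            calc δ ^ 3 * g ^ 3 ≤ ε ^ 2 * δ * g ^ 3 :=
                  mul_le_mul_of_nonneg_right h2 (by positivity)
              _ ≤ ε ^ 2 * δ * (1 + g) ^ 3 := mul_le_mul_of_nonneg_left h3 (by positivity)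
          have h5 : 0 ≤ 3 * v₁ * ε ^ 2 * δ * (1 + g) ^ 3 := by positivity
          nlinarith [h1, h4, h5]

/-! ## Abstract factorisation: a centre times a product of leaves under `Measure.pi` -/

/-- **Star factorisation under a product of copies of a probability measure.**  For a centre label
`a`, distinct leaf labels `bs i ≠ a` (`i < m`), a measurable `F ≥ 0` and jointly measurable
`G_i ≥ 0`:
`∫⁻ F(y a) Π_i G_i(y a, y (bs i)) d(⊗ μ)(y) = ∫⁻ F(z) Π_i (∫⁻ G_i(z, q) dμ(q)) dμ(z)`
(induction on `m`: the last leaf is integrated out by Tonelli over one coordinate,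
`lmarginal_singleton` / `lintegral_eq_of_lmarginal_eq`; the base case is `measurePreserving_eval`).
[folklore] -/
theorem lintegral_pi_centre_mul_prod_eq {ι α : Type*} [Fintype ι] [DecidableEq ι]
    [MeasurableSpace α] (μ : Measure α) [IsProbabilityMeasure μ] (a : ι) :
    ∀ (m : ℕ) (bs : Fin m → ι), Function.Injective bs → (∀ i, bs i ≠ a) →
      ∀ (F : α → ℝ≥0∞), Measurable F → ∀ (G : Fin m → α → α → ℝ≥0∞),
        (∀ i, Measurable (Function.uncurry (G i))) →
        ∫⁻ y, F (y a) * ∏ i, G i (y a) (y (bs i)) ∂Measure.pi (fun _ : ι => μ) =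
          ∫⁻ z, F z * ∏ i, ∫⁻ q, G i z q ∂μ ∂μ := by
  intro m
  induction m with
  | zero =>
      intro bs _ _ F hF G _
      simp only [Finset.univ_eq_empty, Finset.prod_empty, mul_one]
      exact (measurePreserving_eval (fun _ : ι => μ) a).lintegral_comp hF
  | succ m ih =>
      intro bs hbs hba F hF G hG
      have hab : a ≠ bs (Fin.last m) := fun h => hba (Fin.last m) h.symm
      have hcb : ∀ i : Fin m, bs (Fin.castSucc i) ≠ bs (Fin.last m) := fun i h =>
        (Fin.castSucc_lt_last i).ne (hbs h)
      have hGy : ∀ (i : Fin (m + 1)) (j : ι), Measurable fun y : ι → α => G i (y a) (y j) := by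
        intro i j
        have h : Measurable ((Function.uncurry (G i)) ∘ fun y : ι → α => (y a, y j)) :=
          (hG i).comp ((measurable_pi_apply a).prodMk (measurable_pi_apply j))
        exact h
      -- the centre factor after integrating out the last leaf
      have hF' : Measurable fun z => F z * ∫⁻ q, G (Fin.last m) z q ∂μ :=
        hF.mul (hG (Fin.last m)).lintegral_prod_right
      have hf : Measurable fun y : ι → α => F (y a) * ∏ i, G i (y a) (y (bs i)) :=
        (hF.comp (measurable_pi_apply a)).mul (Finset.measurable_prod _ fun i _ => hGy i (bs i))
      have hf' : Measurable fun y : ι → α => (F (y a) * ∫⁻ q, G (Fin.last m) (y a) q ∂μ) *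
          ∏ i : Fin m, G (Fin.castSucc i) (y a) (y (bs (Fin.castSucc i))) :=
        (hF'.comp (measurable_pi_apply a)).mul
          (Finset.measurable_prod _ fun i _ => hGy (Fin.castSucc i) (bs (Fin.castSucc i)))
      -- integrating out the coordinate of the last leaf
      have hmarg : ∫⋯∫⁻_{bs (Fin.last m)}, (fun y : ι → α => F (y a) * ∏ i, G i (y a) (y (bs i)))
            ∂(fun _ : ι => μ) =
          ∫⋯∫⁻_{bs (Fin.last m)}, (fun y : ι → α =>
            (F (y a) * ∫⁻ q, G (Fin.last m) (y a) q ∂μ) *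
              ∏ i : Fin m, G (Fin.castSucc i) (y a) (y (bs (Fin.castSucc i)))) ∂(fun _ : ι => μ) := by
        rw [lmarginal_singleton, lmarginal_singleton]
        funext y
        have hya : ∀ q : α, Function.update y (bs (Fin.last m)) q a = y a := fun q =>
          Function.update_of_ne hab _ _
        have hyc : ∀ (q : α) (i : Fin m), Function.update y (bs (Fin.last m)) q
            (bs (Fin.castSucc i)) = y (bs (Fin.castSucc i)) := fun q i =>
          Function.update_of_ne (hcb i) _ _
        have hyb : ∀ q : α, Function.update y (bs (Fin.last m)) q (bs (Fin.last m)) = q :=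
          fun q => Function.update_self _ _ _
        have h1 : ∀ q : α, F (Function.update y (bs (Fin.last m)) q a) *
            ∏ i, G i (Function.update y (bs (Fin.last m)) q a)
              (Function.update y (bs (Fin.last m)) q (bs i)) =
            (F (y a) * ∏ i : Fin m, G (Fin.castSucc i) (y a) (y (bs (Fin.castSucc i)))) *
              G (Fin.last m) (y a) q := by
          intro q
          rw [Fin.prod_univ_castSucc]
          simp only [hya, hyc, hyb]
          ring
        have h2 : ∀ q : α, (F (Function.update y (bs (Fin.last m)) q a) *
              ∫⁻ q', G (Fin.last m) (Function.update y (bs (Fin.last m)) q a) q' ∂μ) *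
            ∏ i : Fin m, G (Fin.castSucc i) (Function.update y (bs (Fin.last m)) q a)
              (Function.update y (bs (Fin.last m)) q (bs (Fin.castSucc i))) =
            (F (y a) * ∫⁻ q', G (Fin.last m) (y a) q' ∂μ) *
              ∏ i : Fin m, G (Fin.castSucc i) (y a) (y (bs (Fin.castSucc i))) := by
          intro q
          simp only [hya, hyc]
        simp_rw [h1, h2]
        rw [lintegral_const_mul _ (hG (Fin.last m)).of_uncurry_left, lintegral_const, measure_univ,
          mul_one]
        ring
      have step := lintegral_eq_of_lmarginal_eq {bs (Fin.last m)} hf hf' hmarg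
      have hih := ih (fun i => bs (Fin.castSucc i)) (fun i j h => Fin.castSucc_injective _ (hbs h))
        (fun i => hba _) (fun z => F z * ∫⁻ q, G (Fin.last m) z q ∂μ) hF'
        (fun i => G (Fin.castSucc i)) (fun i => hG _)
      rw [step, hih]
      refine lintegral_congr fun z => ?_
      rw [Fin.prod_univ_castSucc]
      ring

/-! ## The leaf integral -/

/-- **One leaf of the star, integrated in its position and velocity** (registered helper stub
`lintegral_leafShell_le` of lead c10's piece W3, the tools half).  For a fixed centre
`z = (x_a, v_a)`, `0 < ε ≤ 1/4`, `0 ≤ δ ≤ ε`: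
`∫∫ 𝟙{ε ≤ d(x_a, x_b) ≤ ε + δ ‖v_a − v_b‖} (1 + ‖v_b‖)^{n'} dx_b dγ(v_b)
  ≤ (3 v₁ + 64) ε² δ (1 + ‖v_a‖)³ ∫ (1 + ‖v‖)^{n'+3} dγ`
(Tonelli with the position inside, `volume_sepVec_shell_le` at `g = ‖v_a − v_b‖`, and
`1 + ‖v_a − v_b‖ ≤ (1 + ‖v_a‖)(1 + ‖v_b‖)`). [folklore] -/
theorem lintegral_leafShell_le :
    ∀ (w : V3) (ϑ : ℝ) (n' : ℕ) {ε δ : ℝ}, 0 < ε → ε ≤ 1 / 4 → 0 ≤ δ → δ ≤ ε → ∀ z : T3 × V3,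
      ∫⁻ q, {q : T3 × V3 | ε ≤ ‖(Torus.geometry (Fin 3)).sepVec z.1 q.1‖ ∧
            ‖(Torus.geometry (Fin 3)).sepVec z.1 q.1‖ ≤ ε + δ * ‖z.2 - q.2‖}.indicator
          (fun q => ENNReal.ofReal ((1 + ‖q.2‖) ^ n')) q ∂(volume : Measure T3).prod (gaussMeasure w ϑ) ≤
        ENNReal.ofReal ((3 * v₁ + 64) * ε ^ 2 * δ * (1 + ‖z.2‖) ^ 3 *
          ∫ v, (1 + ‖v‖) ^ (n' + 3) ∂gaussMeasure w ϑ) := by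
  intro w ϑ n' ε δ hε hε4 hδ hδε z
  have hv := v₁_pos
  -- measurability
  have hd : Measurable fun q : T3 × V3 => ‖(Torus.geometry (Fin 3)).sepVec z.1 q.1‖ :=
    (Torus.measurable_geometry_sepVec.comp (measurable_const.prodMk measurable_fst)).norm
  have hr : Measurable fun q : T3 × V3 => ε + δ * ‖z.2 - q.2‖ :=
    measurable_const.add ((measurable_const.sub measurable_snd).norm.const_mul δ)
  have hS : MeasurableSet {q : T3 × V3 | ε ≤ ‖(Torus.geometry (Fin 3)).sepVec z.1 q.1‖ ∧
      ‖(Torus.geometry (Fin 3)).sepVec z.1 q.1‖ ≤ ε + δ * ‖z.2 - q.2‖} :=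
    (measurableSet_le measurable_const hd).inter (measurableSet_le hd hr)
  have hh : Measurable fun q : T3 × V3 => ENNReal.ofReal ((1 + ‖q.2‖) ^ n') :=
    ENNReal.measurable_ofReal.comp ((measurable_const.add measurable_snd.norm).pow_const n')
  rw [lintegral_prod_symm _ ((hh.indicator hS).aemeasurable)]
  -- the position integral for a fixed leaf velocity
  have hsec : ∀ v : V3,
      ∫⁻ x, {q : T3 × V3 | ε ≤ ‖(Torus.geometry (Fin 3)).sepVec z.1 q.1‖ ∧
          ‖(Torus.geometry (Fin 3)).sepVec z.1 q.1‖ ≤ ε + δ * ‖z.2 - q.2‖}.indicator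
          (fun q => ENNReal.ofReal ((1 + ‖q.2‖) ^ n')) (x, v) ∂(volume : Measure T3) ≤
        ENNReal.ofReal ((3 * v₁ + 64) * ε ^ 2 * δ * (1 + ‖z.2‖) ^ 3 * (1 + ‖v‖) ^ (n' + 3)) := by
    intro v
    have hT : MeasurableSet {x : T3 | ε ≤ ‖(Torus.geometry (Fin 3)).sepVec z.1 x‖ ∧
        ‖(Torus.geometry (Fin 3)).sepVec z.1 x‖ ≤ ε + δ * ‖z.2 - v‖} := by
      have hd' : Measurable fun x : T3 => ‖(Torus.geometry (Fin 3)).sepVec z.1 x‖ :=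
        (Torus.measurable_geometry_sepVec.comp (measurable_const.prodMk measurable_id)).norm
      exact (measurableSet_le measurable_const hd').inter (measurableSet_le hd' measurable_const)
    have heq : ∀ x : T3,
        {q : T3 × V3 | ε ≤ ‖(Torus.geometry (Fin 3)).sepVec z.1 q.1‖ ∧
            ‖(Torus.geometry (Fin 3)).sepVec z.1 q.1‖ ≤ ε + δ * ‖z.2 - q.2‖}.indicator
            (fun q => ENNReal.ofReal ((1 + ‖q.2‖) ^ n')) (x, v) =
          {x : T3 | ε ≤ ‖(Torus.geometry (Fin 3)).sepVec z.1 x‖ ∧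
            ‖(Torus.geometry (Fin 3)).sepVec z.1 x‖ ≤ ε + δ * ‖z.2 - v‖}.indicator
            (fun _ => ENNReal.ofReal ((1 + ‖v‖) ^ n')) x := by
      intro x
      simp only [Set.indicator_apply, mem_setOf_eq]
    simp_rw [heq]
    rw [lintegral_indicator_const hT]
    have hvol := volume_sepVec_shell_le hε hε4 hδ hδε (norm_nonneg (z.2 - v)) z.1
    calc ENNReal.ofReal ((1 + ‖v‖) ^ n') * volume {x : T3 |
          ε ≤ ‖(Torus.geometry (Fin 3)).sepVec z.1 x‖ ∧
            ‖(Torus.geometry (Fin 3)).sepVec z.1 x‖ ≤ ε + δ * ‖z.2 - v‖}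
        ≤ ENNReal.ofReal ((1 + ‖v‖) ^ n') *
            ENNReal.ofReal ((3 * v₁ + 64) * ε ^ 2 * δ * (1 + ‖z.2 - v‖) ^ 3) :=
          mul_le_mul_right hvol _
      _ = ENNReal.ofReal ((1 + ‖v‖) ^ n' * ((3 * v₁ + 64) * ε ^ 2 * δ * (1 + ‖z.2 - v‖) ^ 3)) :=
          (ENNReal.ofReal_mul (by positivity)).symm
      _ ≤ _ := by
          refine ENNReal.ofReal_le_ofReal ?_
          have h1 : (1 + ‖z.2 - v‖) ^ 3 ≤ ((1 + ‖z.2‖) * (1 + ‖v‖)) ^ 3 :=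
            pow_le_pow_left₀ (by positivity) (one_add_norm_sub_le z.2 v) 3
          have h2 : (1 + ‖v‖) ^ n' * ((3 * v₁ + 64) * ε ^ 2 * δ * (1 + ‖z.2 - v‖) ^ 3) ≤
              (1 + ‖v‖) ^ n' * ((3 * v₁ + 64) * ε ^ 2 * δ * ((1 + ‖z.2‖) * (1 + ‖v‖)) ^ 3) :=
            mul_le_mul_of_nonneg_left (mul_le_mul_of_nonneg_left h1 (by positivity))
              (by positivity)
          refine h2.trans (le_of_eq ?_)
          rw [pow_add]
          ring
  have hm : Measurable fun v : V3 => ENNReal.ofReal ((1 + ‖v‖) ^ (n' + 3)) :=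
    ENNReal.measurable_ofReal.comp ((measurable_const.add measurable_norm).pow_const _)
  have hc : 0 ≤ (3 * v₁ + 64) * ε ^ 2 * δ * (1 + ‖z.2‖) ^ 3 := by positivity
  calc ∫⁻ v, ∫⁻ x, {q : T3 × V3 | ε ≤ ‖(Torus.geometry (Fin 3)).sepVec z.1 q.1‖ ∧
          ‖(Torus.geometry (Fin 3)).sepVec z.1 q.1‖ ≤ ε + δ * ‖z.2 - q.2‖}.indicator
          (fun q => ENNReal.ofReal ((1 + ‖q.2‖) ^ n')) (x, v) ∂(volume : Measure T3)
          ∂gaussMeasure w ϑ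
      ≤ ∫⁻ v, ENNReal.ofReal ((3 * v₁ + 64) * ε ^ 2 * δ * (1 + ‖z.2‖) ^ 3 * (1 + ‖v‖) ^ (n' + 3))
          ∂gaussMeasure w ϑ := lintegral_mono hsec
    _ = ∫⁻ v, ENNReal.ofReal ((3 * v₁ + 64) * ε ^ 2 * δ * (1 + ‖z.2‖) ^ 3) *
          ENNReal.ofReal ((1 + ‖v‖) ^ (n' + 3)) ∂gaussMeasure w ϑ := by
        refine lintegral_congr fun v => ?_
        exact ENNReal.ofReal_mul hc
    _ = ENNReal.ofReal ((3 * v₁ + 64) * ε ^ 2 * δ * (1 + ‖z.2‖) ^ 3) *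
          ENNReal.ofReal (∫ v, (1 + ‖v‖) ^ (n' + 3) ∂gaussMeasure w ϑ) := by
        rw [lintegral_const_mul _ hm, lintegral_one_add_norm_pow]
    _ = _ := (ENNReal.ofReal_mul hc).symm

end Summit.AtomisticToContinuum.HydrodynamicLimit.Theorems.LambertianContactSwapLambertianEulerStarShellsTools

end
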